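import Summits.HodgeConjecture.HodgeConjecture.Theorems.EndoscopicMiddleDegreeCupProductAlgebraic
import HarnessLib

/-!
# Crux `AlgebraicOrEnveloped` (stmt-HodgeConjecture-14943), line `pieces_split` — stub 1 `stub_cupProductAlgebraic`

Route `HodgeConjecture/EndoscopicMiddleDegree`; registered skeleton `Cruxes/AlgebraicOrEnveloped/Lines/pieces_split.lean`
(`AlgebraicOrEnveloped_of : CupProductAlgebraic → OrthogonalEnveloped → AlgebraicOrEnveloped`). Its stub 1 is the route's support
item `CupProductAlgebraic` (stmt-HodgeConjecture-14350) BY NAME — cup products of algebraic classes are algebraic,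
`Nˡ H²ˡ ∪ Nᵏ H²ᵏ ⊆ N^{l+k} H^{2(l+k)}` on a smooth projective complex variety — which is PROVED in the tree
(`Theorems.endoscopicMiddleDegree_cupProductAlgebraic_proof`: Voisin II Prop. 9.20 on the real carriers,
`Voisin2003_cupProduct_algebraicClasses_holds`). This file records the fact where the crux's stub registry can see it; the
remaining stub `stub_orthogonalEnveloped` is the sibling crux `OrthogonalEnveloped` (stmt-HodgeConjecture-14300) itself, and the
reductions of both cruxes to that crux's bet are already landed (`EndoscopicMiddleDegreeAlgebraicOrEnvelopedOfBetAlone`,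
`EndoscopicMiddleDegreeOrthogonalEnvelopedOfBetAlone`).

Nothing here is a case of the Hodge conjecture; no definition, no named fact, no sorry.
References: [VoisinHodgeII2003] §9.2.4 Prop. 9.20; [Fulton1998] §19.2 Cor. 19.2 (b).
-/

noncomputable section

-- every declaration of this problem lives in `Summit.HodgeConjecture.HodgeConjecture.…` (summit = sub-problem)
set_option linter.dupNamespace false

open Summit.HodgeConjecture.HodgeConjecture.Theses.EndoscopicMiddleDegree

namespace Summit.HodgeConjecture.HodgeConjecture.Theorems.AlgebraicOrEnveloped

/-- **Stub `stub_cupProductAlgebraic` of crux `AlgebraicOrEnveloped` (registered signature, verbatim): the route's support item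
`CupProductAlgebraic`** — on a smooth projective complex `X`, `a ∈ Nˡ H²ˡ(X)`, `b ∈ Nᵏ H²ᵏ(X)` imply
`a ∪ b ∈ N^{l+k} H^{2l+2k}(X)`. PROVED in the tree: `endoscopicMiddleDegree_cupProductAlgebraic_proof`.
[cite: VoisinHodgeII2003, §9.2.4 Prop. 9.20] [cite: Fulton1998, §19.2 Cor. 19.2 (b)] -/
theorem stub_cupProductAlgebraic : CupProductAlgebraic :=
  endoscopicMiddleDegree_cupProductAlgebraic_proof

end Summit.HodgeConjecture.HodgeConjecture.Theorems.AlgebraicOrEnveloped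

end
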